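import Literature.Geometry.Kaehler.ComplexTorusDivisorBorderedHessianCofactor

/-!
# Tower syzygy — typed core of memo NOBARE-U2LF-semihom2-g2 §3.9 (hsemireg-semihom-2 g2)

EVIDENCE-LEVEL TYPED FILE. Nothing here is proved toward HC ∕ HC_CM ∕ HC_AV ∕ №4 ∕ 26512 ∕ 18881 ∕ H2;
it is not a rung, a seed or a law — it kernel-checks the linear-algebra heart of the «affine-in-charge
lemma ⇒ tower syzygy» used at letter level in §3.9:

* a letter of the U2 alphabet at fixed configuration is `D(t) = A + t · b cᵀ` as the v₄-charge `t`
  runs through the tower `xyz0, xyz1, xyz2` (`A = Σ_{a<4} c_a v_a v_a^*`, `b = v₄`, `c = v̄₄`);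
* every (H1)-cleanness functional and the slot `μ` is a linear combination of MINORS of `D(t)`;
* `det_minor_rankOneLine`: every minor of `A + t · b cᵀ` is AFFINE in `t` (Cauchy's rank-one formula
  without invertibility, `Literature.Geometry.Kaehler.SCV.det_add_col_mul_row`, applied to the submatrix);
* `towerSyzygy_minor` ∕ `towerSyzygy_sum`: hence `F(0) − 2·F(1) + F(2) = 0` for every finite linear
  combination `F` of minors — the exact identity verified numerically 264 306 688 times in
  `data/run-tower-syzygy-g2.log`.
-/

namespace HsemiregSemihom2.TowerSyzygy

open Matrix

variable {m k : Type*} {R : Type*} [CommRing R]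

/-- The column matrix `b` (as an `m × Unit` matrix), in the shape used by `SCV.det_add_col_mul_row`. -/
def colOf (b : m → R) : Matrix m Unit R := Matrix.of fun i (_ : Unit) => b i

/-- The row matrix `cᵀ` (as a `Unit × m` matrix). -/
def rowOf (c : m → R) : Matrix Unit m R := Matrix.of fun (_ : Unit) j => c j

/-- The rank-one line of matrices `t ↦ A + t · b cᵀ` (a tower of letters as the last charge varies). -/
def rankOneLine (A : Matrix m m R) (b c : m → R) (t : R) : Matrix m m R :=
  A + colOf (fun i => t * b i) * rowOf c

theorem colOf_mul_rowOf_apply (b c : m → R) (i j : m) : (colOf b * rowOf c) i j = b i * c j := by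
  simp [colOf, rowOf, Matrix.mul_apply]

/-- A submatrix of a rank-one update is the rank-one update of the submatrix. -/
theorem submatrix_rankOneLine (A : Matrix m m R) (b c : m → R) (t : R) (eR eC : k → m) :
    (rankOneLine A b c t).submatrix eR eC =
      A.submatrix eR eC + colOf (fun i => t * b (eR i)) * rowOf (fun j => c (eC j)) := by
  ext i j
  simp [rankOneLine, Matrix.submatrix_apply, colOf_mul_rowOf_apply]

section Minors

variable [Fintype k] [DecidableEq k]

/-- **Affine-in-charge lemma (minor form).** Every minor of `A + t · b cᵀ` is affine in `t`:
`det (A + t b cᵀ)[eR,eC] = det A[eR,eC] + t · (c∘eC) · adj(A[eR,eC]) · (b∘eR)`. -/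
theorem det_minor_rankOneLine (A : Matrix m m R) (b c : m → R) (t : R) (eR eC : k → m) :
    ((rankOneLine A b c t).submatrix eR eC).det =
      (A.submatrix eR eC).det
        + t * ((fun j => c (eC j)) ⬝ᵥ ((A.submatrix eR eC).adjugate *ᵥ fun i => b (eR i))) := by
  rw [submatrix_rankOneLine]
  have h := Literature.Geometry.Kaehler.SCV.det_add_col_mul_row (A.submatrix eR eC)
    (fun i => t * b (eR i)) (fun j => c (eC j))
  have hs : (fun i => t * b (eR i)) = t • (fun i => b (eR i)) := by
    ext i; simp
  rw [colOf, rowOf] at *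
  rw [h, hs, Matrix.mulVec_smul, dotProduct_smul, smul_eq_mul]

/-- The full determinant is the special case `eR = eC = id`. -/
theorem det_rankOneLine [Fintype m] [DecidableEq m] (A : Matrix m m R) (b c : m → R) (t : R) :
    (rankOneLine A b c t).det = A.det + t * (c ⬝ᵥ (A.adjugate *ᵥ b)) := by
  have h := det_minor_rankOneLine A b c t id id
  simpa using h

/-- **Tower syzygy for one minor**: the second difference along the tower `t = 0, 1, 2` vanishes. -/
theorem towerSyzygy_minor (A : Matrix m m R) (b c : m → R) (eR eC : k → m) :
    ((rankOneLine A b c 0).submatrix eR eC).det - 2 * ((rankOneLine A b c 1).submatrix eR eC).det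
      + ((rankOneLine A b c 2).submatrix eR eC).det = 0 := by
  simp only [det_minor_rankOneLine]
  ring

/-- **Tower syzygy for any finite linear combination of minors** (every cleanness functional and the
slot `μ` of §3.9 is of this form, letter by letter): `F(0) − 2·F(1) + F(2) = 0`. -/
theorem towerSyzygy_sum {ι : Type*} (s : Finset ι) (w : ι → R) (eR eC : ι → k → m)
    (A : Matrix m m R) (b c : m → R) :
    (∑ i ∈ s, w i * ((rankOneLine A b c 0).submatrix (eR i) (eC i)).det)
      - 2 * (∑ i ∈ s, w i * ((rankOneLine A b c 1).submatrix (eR i) (eC i)).det)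
      + (∑ i ∈ s, w i * ((rankOneLine A b c 2).submatrix (eR i) (eC i)).det) = 0 := by
  have h : ∀ i ∈ s,
      w i * ((rankOneLine A b c 0).submatrix (eR i) (eC i)).det
        - 2 * (w i * ((rankOneLine A b c 1).submatrix (eR i) (eC i)).det)
        + w i * ((rankOneLine A b c 2).submatrix (eR i) (eC i)).det = 0 := by
    intro i _
    have e := towerSyzygy_minor A b c (eR i) (eC i)
    linear_combination (w i) * e
  rw [Finset.mul_sum, ← Finset.sum_sub_distrib, ← Finset.sum_add_distrib]
  exact Finset.sum_eq_zero h

/-- Affinity stated as interpolation: `F(t) = (1 − t)·F(0) + t·F(1)` for every minor — the form in which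
§3.9 uses it («[xyz2] ≡ 2[xyz1] − [xyz0]» and the invisible sprinkle `(d₀,d₁,d₂) ↦ (d₀−ε, d₁+2ε, d₂−ε)`). -/
theorem det_minor_rankOneLine_interpolate (A : Matrix m m R) (b c : m → R) (t : R) (eR eC : k → m) :
    ((rankOneLine A b c t).submatrix eR eC).det =
      (1 - t) * ((rankOneLine A b c 0).submatrix eR eC).det
        + t * ((rankOneLine A b c 1).submatrix eR eC).det := by
  simp only [det_minor_rankOneLine]
  ring

end Minors

end HsemiregSemihom2.TowerSyzygy
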